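import Summits.CriticalPhenomena.Ising3DConformalLimit.Theorems.ReflectionTwinExistsContinuousLimitWeightedWord
import Summits.CriticalPhenomena.Ising3DConformalLimit.Theorems.LinkingParityCirclesSpinRatioMoebiusStubTwoPointOfRatioLimit
import HarnessLib

/-!
# K2 `stub_inversionBegetsDilation`: translations and ONE weighted unit inversion beget every dilation
# and pin the weight (crux `ExistsContinuousLimit`, item stmt-CriticalPhenomena-4582, line `Sketch` =
# idea `inversion-before-existence`; `--supports stmt-CriticalPhenomena-4582`)

For a correlation family `S : CorrFamily 3` that is continuous off the diagonals, translation invariant,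
has positive two-point function off the diagonal and is covariant under the unit inversion `ι y = y/‖y‖²`
with SOME positive weight `w` (`S n (ι ∘ x) = (∏ w (x i)) · S n x` off the origin), there is ONE exponent
`Δ` with `IsScaleCovariant Δ S` and `IsInversionCovariant Δ S` — the weight is forced to be `‖y‖^{2Δ}`.

Proof. Part 1 (`…WeightedWord.lean`, `dilation_const_of_pos`): every `c > 0` dilates `S` with a constant
cocycle `Kⁿ`. (C) The constant is read off the two-point function: `S n (c x) = k(c)ⁿ S n x` with
`k(c)² = S₂(0, c e)/S₂(0, e)` (`dilation_eq_k`), `k` multiplicative (`k_mul`) and continuous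
(`k_continuousOn`, continuity of `S₂`), hence `k(c) = c^{α}` (a continuous additive `ℝ → ℝ` is linear,
`map_real_smul`; the tree's `exists_rpow_of_mul_of_continuousOn`) and `S` is scale covariant with `Δ = -α`
(`exists_isScaleCovariant`). (D) `ι² = id` and `ι ∘ D_c = D_{1/c} ∘ ι` at `n = 2` give `w(ιp)w(p) = 1`
(`weight_inversion_mul`) and `w(cp) = c^{2Δ} w(p)` (`weight_smul`), three points each, so
`w(p)² = ‖p‖^{4Δ}` and `w = ‖·‖^{2Δ}` (`weight_eq_rpow`). Normalisation and continuity of `w` are not used.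
References: Di Francesco–Mathieu–Sénéchal 1997 §4.1. [folklore]
-/

noncomputable section

namespace Summit.CriticalPhenomena.Ising3DConformalLimit.ReflectionTwinExistsContinuousLimit

open Literature.Probability.LatticeModels EuclideanGeometry
open Summit.CriticalPhenomena.Ising3DConformalLimit.PrecisionLaplacianMoebiusLimitOfTwoPointLaw
open Summit.CriticalPhenomena.Ising3DConformalLimit.Cruxes.SpinRatioMoebius.Birth (exists_rpow_of_mul_of_continuousOn)

/-! ### (C) The constant is a power: scale covariance -/

section Scale

variable {S : CorrFamily 3} {w : EuclideanSpace ℝ (Fin 3) → ℝ}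

variable {e : EuclideanSpace ℝ (Fin 3)}

/-- The axis pair `(0, c e)` is non-coincident for `c ≠ 0`, `e ≠ 0`. [folklore] -/
theorem axisPair_mem (he : e ≠ 0) {c : ℝ} (hc : c ≠ 0) :
    (![0, c • e] : Fin 2 → EuclideanSpace ℝ (Fin 3)) ∈ NonCoincident 3 2 :=
  pair_mem_nonCoincident (by rw [ne_comm, smul_ne_zero_iff]; exact ⟨hc, he⟩)

/-- **(C₁) The dilation constant is read off the two-point function**: with
`k(c) = √(S₂(0, c e)/S₂(0, e))`, `S n (c x) = k(c)ⁿ S n x` for all `c > 0`, `n`, `x`. [folklore] -/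
theorem dilation_eq_k (htr : IsTranslationInvariant S) (hnd : IsNondegenerateTwoPoint S)
    (hwpos : ∀ v, v ≠ 0 → 0 < w v)
    (hcov : ∀ (n : ℕ) (x : Fin n → EuclideanSpace ℝ (Fin 3)), (∀ i, x i ≠ 0) →
      S n (fun i => inversion (0 : EuclideanSpace ℝ (Fin 3)) 1 (x i)) = (∏ i, w (x i)) * S n x)
    (he : e ≠ 0) {c : ℝ} (hc : 0 < c) (n : ℕ) (x : Fin n → EuclideanSpace ℝ (Fin 3)) :
    S n (fun i => c • x i) = (Real.sqrt (S 2 ![0, c • e] / S 2 ![0, e])) ^ n * S n x := by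
  obtain ⟨K, hK, h⟩ := dilation_const_of_pos S w htr hnd hwpos hcov c hc
  have h2 := h 2 ![0, e]
  have hcfg : (fun i => c • (![0, e] : Fin 2 → EuclideanSpace ℝ (Fin 3)) i) = ![0, c • e] := by
    funext i; fin_cases i <;> simp
  rw [hcfg] at h2
  have hpos : 0 < S 2 ![0, e] := by
    have := hnd _ (axisPair_mem he one_ne_zero)
    rwa [one_smul] at this
  have hK2 : K = Real.sqrt (S 2 ![0, c • e] / S 2 ![0, e]) := by
    rw [h2, mul_div_assoc, div_self hpos.ne', mul_one, Real.sqrt_sq hK.le]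
  rw [← hK2]
  exact h n x

/-- **(C₂) `k` is multiplicative** on `(0, ∞)`. [folklore] -/
theorem k_mul (htr : IsTranslationInvariant S) (hnd : IsNondegenerateTwoPoint S)
    (hwpos : ∀ v, v ≠ 0 → 0 < w v)
    (hcov : ∀ (n : ℕ) (x : Fin n → EuclideanSpace ℝ (Fin 3)), (∀ i, x i ≠ 0) →
      S n (fun i => inversion (0 : EuclideanSpace ℝ (Fin 3)) 1 (x i)) = (∏ i, w (x i)) * S n x)
    (he : e ≠ 0) {c d : ℝ} (hc : 0 < c) (hd : 0 < d) :
    Real.sqrt (S 2 ![0, (c * d) • e] / S 2 ![0, e])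
      = Real.sqrt (S 2 ![0, c • e] / S 2 ![0, e]) * Real.sqrt (S 2 ![0, d • e] / S 2 ![0, e]) := by
  have hpos : 0 < S 2 ![0, e] := by
    have := hnd _ (axisPair_mem he one_ne_zero)
    rwa [one_smul] at this
  have h1 := dilation_eq_k htr hnd hwpos hcov he (mul_pos hc hd) 2 ![0, e]
  have h2 := dilation_eq_k htr hnd hwpos hcov he hc 2 (fun i => d • (![0, e] : Fin 2 → _) i)
  have h3 := dilation_eq_k htr hnd hwpos hcov he hd 2 ![0, e]
  have hcfg : (fun i => (c * d) • (![0, e] : Fin 2 → EuclideanSpace ℝ (Fin 3)) i)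
      = fun i => c • (d • (![0, e] : Fin 2 → EuclideanSpace ℝ (Fin 3)) i) :=
    funext fun i => mul_smul _ _ _
  rw [hcfg, h2, h3, ← mul_assoc, ← mul_pow] at h1
  have h := mul_right_cancel₀ hpos.ne' h1
  exact (pow_left_inj₀ (Real.sqrt_nonneg _) (mul_nonneg (Real.sqrt_nonneg _) (Real.sqrt_nonneg _))
    two_ne_zero).1 h.symm

/-- **(C₃) `k` is continuous** on `(0, ∞)` (continuity of `S₂` off the diagonal). [folklore] -/
theorem k_continuousOn (hcont : ∀ n, ContinuousOn (S n) (NonCoincident 3 n)) (he : e ≠ 0) :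
    ContinuousOn (fun c : ℝ => Real.sqrt (S 2 ![0, c • e] / S 2 ![0, e])) (Set.Ioi 0) := by
  have hmap : ContinuousOn (fun c : ℝ => (![0, c • e] : Fin 2 → EuclideanSpace ℝ (Fin 3))) (Set.Ioi 0) :=
    (continuous_const.matrixVecCons
      (((continuous_id (X := ℝ)).smul continuous_const).matrixVecCons continuous_const)).continuousOn
  have hS : ContinuousOn (fun c : ℝ => S 2 ![0, c • e]) (Set.Ioi 0) :=
    (hcont 2).comp hmap fun c hc => axisPair_mem he (ne_of_gt hc)
  exact Real.continuous_sqrt.comp_continuousOn (hS.div_const _)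

/-- **(C) Scale covariance**: a translation-invariant family with positive two-point function,
continuous off the diagonals and covariant under the unit inversion with a positive weight is scale
covariant with some exponent `Δ`; moreover `Δ` is the one read off any axis pair. [folklore] -/
theorem exists_isScaleCovariant (hcont : ∀ n, ContinuousOn (S n) (NonCoincident 3 n))
    (htr : IsTranslationInvariant S) (hnd : IsNondegenerateTwoPoint S)
    (hwpos : ∀ v, v ≠ 0 → 0 < w v)
    (hcov : ∀ (n : ℕ) (x : Fin n → EuclideanSpace ℝ (Fin 3)), (∀ i, x i ≠ 0) →
      S n (fun i => inversion (0 : EuclideanSpace ℝ (Fin 3)) 1 (x i)) = (∏ i, w (x i)) * S n x) :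
    ∃ Δ : ℝ, IsScaleCovariant Δ S := by
  obtain ⟨e, he1⟩ := exists_norm_eq (EuclideanSpace ℝ (Fin 3)) zero_le_one
  have he : e ≠ 0 := by rw [← norm_ne_zero_iff, he1]; exact one_ne_zero
  set k : ℝ → ℝ := fun c => Real.sqrt (S 2 ![0, c • e] / S 2 ![0, e]) with hk
  have hS0 : 0 < S 2 ![0, e] := by
    have := hnd _ (axisPair_mem he one_ne_zero)
    rwa [one_smul] at this
  have hkpos : ∀ c, 0 < c → 0 < k c := fun c hc =>
    Real.sqrt_pos.2 (div_pos (hnd _ (axisPair_mem he hc.ne')) hS0)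
  have hkmul : ∀ c d, 0 < c → 0 < d → k (c * d) = k c * k d := fun c d hc hd =>
    k_mul htr hnd hwpos hcov he hc hd
  obtain ⟨α, hα⟩ := exists_rpow_of_mul_of_continuousOn hkpos (k_continuousOn hcont he) hkmul
  refine ⟨-α, fun n c hc x => ?_⟩
  rw [dilation_eq_k htr hnd hwpos hcov he hc n x]
  change k c ^ n * S n x = _
  rw [hα c hc, ← Real.rpow_mul_natCast hc.le]
  congr 1
  ring_nf

end Scale

/-! ### (D) The weight is `‖·‖^{2Δ}` -/

section Weight

variable {S : CorrFamily 3} {w : EuclideanSpace ℝ (Fin 3) → ℝ} {Δ : ℝ}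

/-- Three-point argument: a positive function on `ℝ³ ∖ {0}` with `φ p φ q = 1` for all distinct nonzero
`p, q` is identically `1`. [folklore] -/
theorem eq_one_of_pairwise_mul_eq_one {φ : EuclideanSpace ℝ (Fin 3) → ℝ} (hpos : ∀ p, p ≠ 0 → 0 < φ p)
    (h : ∀ p q, p ≠ 0 → q ≠ 0 → p ≠ q → φ p * φ q = 1) (p : EuclideanSpace ℝ (Fin 3)) (hp : p ≠ 0) :
    φ p = 1 := by
  have h2 : (2 : ℝ) • p ≠ 0 := smul_ne_zero two_ne_zero hp
  have h3 : (3 : ℝ) • p ≠ 0 := smul_ne_zero three_ne_zero hp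
  have hp2 : p ≠ (2 : ℝ) • p := by
    intro e
    have : (1 : ℝ) • p = (2 : ℝ) • p := by rwa [one_smul]
    exact absurd (smul_left_injective ℝ hp this) (by norm_num)
  have hp3 : p ≠ (3 : ℝ) • p := by
    intro e
    have : (1 : ℝ) • p = (3 : ℝ) • p := by rwa [one_smul]
    exact absurd (smul_left_injective ℝ hp this) (by norm_num)
  have h23 : (2 : ℝ) • p ≠ (3 : ℝ) • p := fun e =>
    absurd (smul_left_injective ℝ hp e) (by norm_num)
  have a := h _ _ hp h2 hp2
  have b := h _ _ hp h3 hp3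
  have c := h _ _ h2 h3 h23
  have hsq : φ p ^ 2 = 1 := by
    have e : φ p ^ 2 * (φ ((2 : ℝ) • p) * φ ((3 : ℝ) • p)) = 1 := by
      linear_combination (φ p * φ ((3 : ℝ) • p)) * a + b
    rw [c, mul_one] at e
    exact e
  have := (pow_left_inj₀ (hpos p hp).le zero_le_one two_ne_zero).1 (by rw [hsq, one_pow])
  exact this

/-- The inverted pair of distinct nonzero points. [folklore] -/
theorem inv_pair_cfg (p q : EuclideanSpace ℝ (Fin 3)) :
    (fun i => inversion (0 : EuclideanSpace ℝ (Fin 3)) 1 ((![p, q] : Fin 2 → _) i))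
      = ![inversion (0 : EuclideanSpace ℝ (Fin 3)) 1 p, inversion (0 : EuclideanSpace ℝ (Fin 3)) 1 q] := by
  funext i; fin_cases i <;> simp

/-- **(D₁) Involution**: `w(ιp) w(p) = 1` off the origin (from `ι² = id` at `n = 2` and three points).
[folklore] -/
theorem weight_inversion_mul (hnd : IsNondegenerateTwoPoint S) (hwpos : ∀ v, v ≠ 0 → 0 < w v)
    (hcov : ∀ (n : ℕ) (x : Fin n → EuclideanSpace ℝ (Fin 3)), (∀ i, x i ≠ 0) →
      S n (fun i => inversion (0 : EuclideanSpace ℝ (Fin 3)) 1 (x i)) = (∏ i, w (x i)) * S n x)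
    (p : EuclideanSpace ℝ (Fin 3)) (hp : p ≠ 0) :
    w (inversion (0 : EuclideanSpace ℝ (Fin 3)) 1 p) * w p = 1 := by
  refine eq_one_of_pairwise_mul_eq_one (φ := fun v => w (inversion 0 1 v) * w v)
    (fun v hv => mul_pos (hwpos _ ((inversion_eq_center one_ne_zero).not.2 hv)) (hwpos _ hv)) ?_ p hp
  intro p q hp hq hpq
  have hip : inversion (0 : EuclideanSpace ℝ (Fin 3)) 1 p ≠ 0 := (inversion_eq_center one_ne_zero).not.2 hp
  have hiq : inversion (0 : EuclideanSpace ℝ (Fin 3)) 1 q ≠ 0 := (inversion_eq_center one_ne_zero).not.2 hq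
  have hpos : 0 < S 2 ![p, q] := hnd _ (pair_mem_nonCoincident hpq)
  -- apply covariance twice: at `(ιp, ιq)` and at `(p, q)`
  have k1 := hcov 2 ![inversion 0 1 p, inversion 0 1 q] (fun i => by fin_cases i; exacts [hip, hiq])
  have k2 := hcov 2 ![p, q] (fun i => by fin_cases i; exacts [hp, hq])
  rw [inv_pair_cfg, Fin.prod_univ_two] at k1 k2
  simp only [Matrix.cons_val_zero, Matrix.cons_val_one,
    inversion_inversion _ one_ne_zero] at k1 k2
  rw [k2, ← mul_assoc] at k1
  -- k1 : S 2 ![p, q] = (w (ι p) * w (ι q)) * (w p * w q) * S 2 ![p, q]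
  have h := mul_right_cancel₀ hpos.ne' (k1.symm.trans (one_mul _).symm)
  linear_combination h

/-- **(D₂) Homogeneity**: `w(cp) = c^{2Δ} w(p)` off the origin for `c > 0` (from
`ι ∘ D_c = D_{1/c} ∘ ι` at `n = 2`, scale covariance, and three points). [folklore] -/
theorem weight_smul (hnd : IsNondegenerateTwoPoint S) (hwpos : ∀ v, v ≠ 0 → 0 < w v)
    (hcov : ∀ (n : ℕ) (x : Fin n → EuclideanSpace ℝ (Fin 3)), (∀ i, x i ≠ 0) →
      S n (fun i => inversion (0 : EuclideanSpace ℝ (Fin 3)) 1 (x i)) = (∏ i, w (x i)) * S n x)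
    (hsc : IsScaleCovariant Δ S) {c : ℝ} (hc : 0 < c) (p : EuclideanSpace ℝ (Fin 3)) (hp : p ≠ 0) :
    w (c • p) = c ^ (2 * Δ) * w p := by
  have hc2 : 0 < c ^ (2 * Δ) := Real.rpow_pos_of_pos hc _
  suffices h : w (c • p) / (c ^ (2 * Δ) * w p) = 1 by
    rwa [div_eq_one_iff_eq (mul_pos hc2 (hwpos p hp)).ne'] at h
  refine eq_one_of_pairwise_mul_eq_one (φ := fun v => w (c • v) / (c ^ (2 * Δ) * w v))
    (fun v hv => div_pos (hwpos _ (smul_ne_zero hc.ne' hv)) (mul_pos hc2 (hwpos v hv))) ?_ p hp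
  intro p q hp hq hpq
  have hcp : c • p ≠ 0 := smul_ne_zero hc.ne' hp
  have hcq : c • q ≠ 0 := smul_ne_zero hc.ne' hq
  have hpos : 0 < S 2 ![p, q] := hnd _ (pair_mem_nonCoincident hpq)
  -- way 1: covariance at `(cp, cq)`, then scale covariance
  have k1 := hcov 2 ![c • p, c • q] (fun i => by fin_cases i; exacts [hcp, hcq])
  rw [inv_pair_cfg, Fin.prod_univ_two] at k1
  simp only [Matrix.cons_val_zero, Matrix.cons_val_one] at k1
  have s1 := hsc 2 c hc ![p, q]
  have hcfg1 : (fun i => c • (![p, q] : Fin 2 → EuclideanSpace ℝ (Fin 3)) i) = ![c • p, c • q] := by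
    funext i; fin_cases i <;> simp
  rw [hcfg1] at s1
  rw [s1] at k1
  -- way 2: `ι(cv) = c⁻¹ ι v`, scale covariance, covariance at `(p, q)`
  have hinv : ∀ v : EuclideanSpace ℝ (Fin 3), inversion (0 : EuclideanSpace ℝ (Fin 3)) 1 (c • v)
      = c⁻¹ • inversion (0 : EuclideanSpace ℝ (Fin 3)) 1 v := by
    intro v
    rw [inversion_smul_eq hc.ne', inversion_zero_one_eq_smul, smul_smul, mul_inv]
  have s2 := hsc 2 c⁻¹ (inv_pos.2 hc) ![inversion 0 1 p, inversion 0 1 q]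
  have hcfg2 : (fun i => c⁻¹ • (![inversion (0 : EuclideanSpace ℝ (Fin 3)) 1 p, inversion 0 1 q] :
      Fin 2 → EuclideanSpace ℝ (Fin 3)) i) = ![inversion 0 1 (c • p), inversion 0 1 (c • q)] := by
    funext i; fin_cases i <;> simp [hinv]
  rw [hcfg2] at s2
  have k2 := hcov 2 ![p, q] (fun i => by fin_cases i; exacts [hp, hq])
  rw [inv_pair_cfg, Fin.prod_univ_two] at k2
  simp only [Matrix.cons_val_zero, Matrix.cons_val_one] at k2
  rw [k2] at s2
  -- compare
  rw [s2] at k1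
  -- k1 : c⁻¹ ^ (-(2:ℝ) * Δ) * (w p * w q * S 2 ![p, q]) = w (c • p) * w (c • q) * (c ^ (-(2:ℝ) * Δ) * S 2 ![p, q])
  have e1 : (c⁻¹ : ℝ) ^ (-((2 : ℕ) : ℝ) * Δ) = c ^ (2 * Δ) := by
    rw [Real.inv_rpow hc.le, ← Real.rpow_neg hc.le]
    norm_num
  have e2 : (c : ℝ) ^ (-((2 : ℕ) : ℝ) * Δ) = (c ^ (2 * Δ))⁻¹ := by
    rw [← Real.rpow_neg hc.le]
    norm_num
  rw [e1, e2] at k1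
  -- k1 : c^(2Δ) * (w p * w q * S₂) = w (c • p) * w (c • q) * ((c^(2Δ))⁻¹ * S₂)
  have hca : c ^ (2 * Δ) * (c ^ (2 * Δ))⁻¹ = 1 := mul_inv_cancel₀ hc2.ne'
  have h := mul_right_cancel₀ hpos.ne' (show w (c • p) * w (c • q) * S 2 ![p, q]
      = c ^ (2 * Δ) * c ^ (2 * Δ) * (w p * w q) * S 2 ![p, q] by
    linear_combination (-(c ^ (2 * Δ))) * k1 + (-(w (c • p) * w (c • q) * S 2 ![p, q])) * hca)
  have hwp := (hwpos p hp).ne'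
  have hwq := (hwpos q hq).ne'
  have hc2' := hc2.ne'
  field_simp
  linear_combination h

/-- **(D) The weight is the conformal factor**: `w p = ‖p‖^{2Δ}` off the origin. [folklore] -/
theorem weight_eq_rpow (hnd : IsNondegenerateTwoPoint S) (hwpos : ∀ v, v ≠ 0 → 0 < w v)
    (hcov : ∀ (n : ℕ) (x : Fin n → EuclideanSpace ℝ (Fin 3)), (∀ i, x i ≠ 0) →
      S n (fun i => inversion (0 : EuclideanSpace ℝ (Fin 3)) 1 (x i)) = (∏ i, w (x i)) * S n x)
    (hsc : IsScaleCovariant Δ S) (p : EuclideanSpace ℝ (Fin 3)) (hp : p ≠ 0) :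
    w p = ‖p‖ ^ (2 * Δ) := by
  have hn : 0 < ‖p‖ := norm_pos_iff.2 hp
  have h1 := weight_inversion_mul hnd hwpos hcov p hp
  have h2 := weight_smul hnd hwpos hcov hsc (inv_pos.2 (pow_pos hn 2)) p hp
  rw [inversion_zero_one_eq_smul, h2] at h1
  -- h1 : (‖p‖²)⁻¹ ^ (2Δ) * w p * w p = 1
  have e : ((‖p‖ ^ 2)⁻¹ : ℝ) ^ (2 * Δ) = ((‖p‖ ^ (2 * Δ)) ^ 2)⁻¹ := by
    rw [Real.inv_rpow (pow_nonneg hn.le 2)]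
    congr 1
    rw [← Real.rpow_natCast ‖p‖ 2, ← Real.rpow_mul hn.le, ← Real.rpow_natCast (‖p‖ ^ (2 * Δ)) 2,
      ← Real.rpow_mul hn.le]
    congr 1
    push_cast
    ring
  rw [e] at h1
  have hq : 0 < ‖p‖ ^ (2 * Δ) := Real.rpow_pos_of_pos hn _
  have hq2 : ((‖p‖ ^ (2 * Δ)) ^ 2 : ℝ) ≠ 0 := pow_ne_zero 2 hq.ne'
  have hsq : w p ^ 2 = (‖p‖ ^ (2 * Δ)) ^ 2 := by
    rw [mul_assoc, inv_mul_eq_iff_eq_mul₀ hq2, mul_one] at h1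
    linear_combination h1
  exact (pow_left_inj₀ (hwpos p hp).le hq.le two_ne_zero).1 hsq

end Weight

/-! ### The stub -/

/-- **K2 `stub_inversionBegetsDilation` (registered stub of line `Sketch`, crux stmt-CriticalPhenomena-4582):
translations and ONE weighted unit inversion beget every dilation and pin the weight.** For a normalised,
continuous-off-the-diagonals, translation-invariant `S : CorrFamily 3` with positive two-point function,
covariance under `x ↦ x/‖x‖²` with SOME positive weight `w` forces scale covariance and inversion covariance
with one exponent `Δ` (and `w = ‖·‖^{2Δ}`). Normalisation and continuity of `w` are not used. [folklore] -/
theorem stub_inversionBegetsDilation :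
    ∀ S : Literature.Probability.LatticeModels.CorrFamily 3,
      (∀ n z, z ∉ Literature.Probability.LatticeModels.NonCoincident 3 n → S n z = 0) →
      (∀ n, ContinuousOn (S n) (Literature.Probability.LatticeModels.NonCoincident 3 n)) →
      Literature.Probability.LatticeModels.IsTranslationInvariant S →
      Literature.Probability.LatticeModels.IsNondegenerateTwoPoint S →
      ∀ w : EuclideanSpace ℝ (Fin 3) → ℝ, (∀ v, v ≠ 0 → 0 < w v) → ContinuousOn w {0}ᶜ →
      (∀ (n : ℕ) (x : Fin n → EuclideanSpace ℝ (Fin 3)), (∀ i, x i ≠ 0) →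
        S n (fun i => EuclideanGeometry.inversion (0 : EuclideanSpace ℝ (Fin 3)) 1 (x i)) =
          (∏ i, w (x i)) * S n x) →
      ∃ Δ : ℝ, Literature.Probability.LatticeModels.IsScaleCovariant Δ S ∧
        Literature.Probability.LatticeModels.IsInversionCovariant Δ S := by
  intro S _hN hcont htr hnd w hwpos _hwcont hcov
  obtain ⟨Δ, hsc⟩ := exists_isScaleCovariant hcont htr hnd hwpos hcov
  refine ⟨Δ, hsc, fun n x hx => ?_⟩
  rw [hcov n x hx]
  congr 1
  exact Finset.prod_congr rfl fun i _ => weight_eq_rpow hnd hwpos hcov hsc (x i) (hx i)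

end Summit.CriticalPhenomena.Ising3DConformalLimit.ReflectionTwinExistsContinuousLimit

end
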